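import Summits.BirchSwinnertonDyer.BirchSwinnertonDyer.Theorems.SignedLowerHalvesSmallImageMuZeroOneSignCleanAtP
import Summits.BirchSwinnertonDyer.BirchSwinnertonDyer.Theorems.SignedLowerHalvesSmallImageMuZeroOneSignFinePivotOneSign
import Summits.BirchSwinnertonDyer.BirchSwinnertonDyer.Theorems.QuadraticBranchSignedControlPlusEtaNonsurjConjADoor
import Literature.NumberTheory.EllipticCurves.Rank1Residual.Typed.X7
import HarnessLib

/-!
# Route `SignedLowerHalves` (K3), crux M `SmallImageMuZeroOneSign` (item stmt-BirchSwinnertonDyer-23600), line `birth_mu` —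
# crux M AT A PAIR from ONE class number, modulo the three printed binders ONLY (the per-pair door with (c1) AND (c3) discharged)

LEAD seat `cruxlead-stmt-BirchSwinnertonDyer-23600` gen 3 (cell `bsd-ssimc`; `--supports stmt-BirchSwinnertonDyer-23600`, helper).
HONEST FRAMING: THEOREMS ONLY (no definition, no named fact, no instance, no `sorry`); CONDITIONAL where binders are displayed
(the three printed facts `hKP`, `hKo`, `hMa` of the lead's fine-pivot lever; the class-number datum is a per-pair HYPOTHESIS);
crux M, crux 4, Conjecture A and BSD are NOT proved and are claimed for no pair.  A certificate closes M AT A PAIR, never the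
class-wide crux (the domain is infinite at `p ∈ {3, 5, 7, 11}`).

WHAT.  The crux's second line `Lines/fine_pivot.lean` v1.5 (bsd-idea-5 g12, published W-79) typed the per-pair doors
«`p ∤ h(ℚ(E[p]))` resp. `p ∤ h(ℚ(P))` for ONE non-zero `P ∈ E[p]`, plus `CleanAtP W p` ⟹ `ConjAAt W p`» (§Door 1‴, via the
conjA-anchor kernel theorems `CoatesSujatha2005.conjA_of_not_dvd_card_classGroup` / `conjA_of_eigenHom_subfield`) and their
composition with the lead's landed lever `SmallImageFinePivot.oneSignMuZero_of_conjAAt` (§Door 1⁗: M at the pair modulo the three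
prints).  Cell `bsd-potss` (K8, seat k8eta-c2 g20, `Theorems/QuadraticBranchSignedControlPlusEtaNonsurjConjADoor.lean`) landed the
curve-generic door `EtaConjADoor.conjA_of_not_dvd_classNumber_stabilizerField` with (c3) displayed, and discharged (c1), (c3) on ITS
rows (`5 ≤ p`, tower not onto) by the inertial `−1` (`exists_mem_inertia_smul_eq_neg_of_goodSS`).  This file READS both on crux M's
domain (`p ≠ 2`, `ClassX7`, `¬ Surj`; `p = 3` included) with (c3) = `SmallImageCleanAtP.cleanAtP_of_goodSS` (gen 3, p693187) and
(c1) = `SmallImageDickson.not_dvd_card_aut_divisionField` + `ClassX7.irr`: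

* `conjAAt_of_not_dvd_classNumber_divisionField` — **`p ∤ h(ℚ(E[p]))` ⟹ `ConjAAt W p`** on the domain, FACT-FREE, hypothesis-free
  but for the class number.
* `conjAAt_of_not_dvd_classNumber_stabilizerField` — **`p ∤ h(ℚ(P))` for ONE `P ∈ E[p] ∖ 0` ⟹ `ConjAAt W p`** (`[ℚ(P):ℚ] = p² − 1`
  when `im ρ̄ = N(C_ns(p))`: 8 at `p = 3`, 24 at `p = 5`, 48 at `p = 7` — the kit currency ASK-1′ of the cell), FACT-FREE.
* `fineMuZeroAt_of_not_dvd_classNumber_stabilizerField` — hence `FineMuZeroAt W p` (tree `ConjAAt.fineMuZeroAt`).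
* `oneSignMuZero_of_not_dvd_classNumber_divisionField` / `…_stabilizerField` — **crux M's body AT THE PAIR from ONE class number,
  modulo the three printed binders of the lever ONLY** (no `CleanAtP`, no S1 stub, no Iwasawa-1956 fact, no isotypic descent).
* `dvd_classNumber_stabilizerField_of_not_oneSignMuZero` — the contrapositive = the disprover's NECESSARY CONDITION: modulo print, a
  domain pair where M fails has `p ∣ h(ℚ(P))` for EVERY non-zero `P ∈ E[p]` (and `p ∣ h(ℚ(E[p]))`).

References: [CoatesSujatha2005] §3 Conjecture A, Thm. 3.4, Lemma 3.8; [DeoRaySujatha2023] §3 Thm. 3.8 (c1)–(c3), Thm. 3.9 (b)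
(arXiv:2202.09937 pp. 9–10); [Serre1972] §1.11 Prop. 12, §2.4 Prop. 15; [KuriharaPollack2007] §1.2, §3 p. 328; [Matar2020] Thm. 1.1;
[Kobayashi2003] Thm. 1.2; [NeukirchANT1999] Ch. I §6.
-/

set_option autoImplicit false
set_option linter.dupNamespace false

noncomputable section

open scoped Classical NumberField

open IsDedekindDomain Field NumberField WeierstrassCurve IntermediateField
  Literature.NumberTheory.EllipticCurves Literature.NumberTheory.GaloisRepresentations
  Literature.NumberTheory.EllipticCurves.Rank1Residual Literature.NumberTheory.EllipticCurves.Kobayashi2003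
  Summit.BirchSwinnertonDyer.Rank1Residual.X1.MuLambda

namespace Summit.BirchSwinnertonDyer.BirchSwinnertonDyer.Theorems.SmallImageCleanAtP

variable (W : WeierstrassCurve ℚ) [W.IsElliptic] [W.IsGloballyMinimal] (p : ℕ) [hp : Fact p.Prime]

/-! ## §1 Conjecture A at a pair of the domain from ONE class number — fact-free, (c1) and (c3) discharged -/

/-- **`p ∤ h(ℚ(E[p]))` ⟹ statement (A) at the pair**, on crux M's domain (`p ≠ 2`, `ClassX7 W p`, `ρ̄_{E,p}` not onto), FACT-FREE:
conjA-anchor `CoatesSujatha2005.conjA_of_not_dvd_card_classGroup` with (c1) `p ∤ #Gal(ℚ(E[p])/ℚ)` by Serre's Prop. 15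
(`SmallImageDickson.not_dvd_card_aut_divisionField`, `E[p]` irreducible at a good supersingular odd `p`) and (c3) `E(ℚ_p)[p] = 0` by
`cleanAtP_of_goodSS`.  `¬ HasCM` and `a_p = 0` are not needed. [cite: CoatesSujatha2005, §3 Thm. 3.4 and Lemma 3.8]
[cite: DeoRaySujatha2023, §3 Thm. 3.9 (b) (arXiv:2202.09937 p. 10)] [cite: Serre1972, §2.4 Prop. 15] -/
theorem conjAAt_of_not_dvd_classNumber_divisionField [NeZero p] (hp2 : p ≠ 2) (h7 : ClassX7 W p) (hns : ¬ Surj W p)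
    (hh : haveI : NumberField ↥(W.divisionField p) := NumberField.mk
      ¬ p ∣ NumberField.classNumber ↥(W.divisionField p)) : ConjAAt W p := by
  haveI : NumberField ↥(W.divisionField p) := NumberField.mk
  have hc : NumberField.classNumber ↥(W.divisionField p) = Nat.card (ClassGroup (𝓞 ↥(W.divisionField p))) := by
    unfold NumberField.classNumber
    exact Fintype.card_eq_nat_card
  rw [hc] at hh
  intro κ hκ
  exact CoatesSujatha2005.conjA_of_not_dvd_card_classGroup W hp2
    (AdditiveBranchIMCGordTwoRankOne.SmallImageDickson.not_dvd_card_aut_divisionField W p (ClassX7.irr W p hp2 h7) hns)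
    hh hκ (cleanAtP_of_goodSS W p hp2 h7.1)

/-- **`p ∤ h(ℚ(P))` for ONE non-zero `P ∈ E[p]` ⟹ statement (A) at the pair**, on crux M's domain, FACT-FREE: the curve-generic
door `EtaConjADoor.conjA_of_not_dvd_classNumber_stabilizerField` (cell `bsd-potss`, conjA-anchor `CoatesSujatha2005.conjA_of_eigenHom_subfield`
with the eigen-test emptied by `p ∤ h`) with (c1) by Serre's Prop. 15 and (c3) by `cleanAtP_of_goodSS`.  Here `ℚ(P)` is the fixed
field, inside `ℚ(E[p])`, of the image of `Stab_{Γ_ℚ}(P)`; on the domain `[ℚ(P):ℚ] = p² − 1` (the ASK-1′ currency).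
[cite: DeoRaySujatha2023, §3 Thm. 3.8 (c2), Thm. 3.9 (b) (arXiv:2202.09937 pp. 9–10)] [cite: CoatesSujatha2005, §3 Thm. 3.4 and Lemma 3.8]
[cite: Serre1972, §2.4 Prop. 15] -/
theorem conjAAt_of_not_dvd_classNumber_stabilizerField [NeZero p] (hp2 : p ≠ 2) (h7 : ClassX7 W p) (hns : ¬ Surj W p)
    (P : geomTorsion W (p : ℤ)) (hP : P ≠ 0)
    (hh : haveI : NumberField ↥(W.divisionField p) := NumberField.mk
      ¬ p ∣ NumberField.classNumber ↥(fixedField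
        ((MulAction.stabilizer (absoluteGaloisGroup ℚ) P).map (absRestrictNormalHom (W.divisionField p)))))
    : ConjAAt W p := fun _ hκ ↦
  EtaConjADoor.conjA_of_not_dvd_classNumber_stabilizerField p W hp2 (ClassX7.irr W p hp2 h7)
    (AdditiveBranchIMCGordTwoRankOne.SmallImageDickson.not_dvd_card_aut_divisionField W p (ClassX7.irr W p hp2 h7) hns)
    ⟨P, hP, hh⟩ hκ (cleanAtP_of_goodSS W p hp2 h7.1)

/-- **`p ∤ h(ℚ(P))` ⟹ `μ(X₀(E/ℚ_∞)) = 0` pointwise** (`FineMuZeroAt W p`, tree `ConjAAt.fineMuZeroAt`), on the domain, FACT-FREE.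
[cite: CoatesSujatha2005, §3 statement (A), `μ`-form] [cite: DeoRaySujatha2023, §3 Thm. 3.9 (b)] -/
theorem fineMuZeroAt_of_not_dvd_classNumber_stabilizerField [NeZero p] (hp2 : p ≠ 2) (h7 : ClassX7 W p) (hns : ¬ Surj W p)
    (P : geomTorsion W (p : ℤ)) (hP : P ≠ 0)
    (hh : haveI : NumberField ↥(W.divisionField p) := NumberField.mk
      ¬ p ∣ NumberField.classNumber ↥(fixedField
        ((MulAction.stabilizer (absoluteGaloisGroup ℚ) P).map (absRestrictNormalHom (W.divisionField p)))))
    : FineMuZeroAt W p :=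
  (conjAAt_of_not_dvd_classNumber_stabilizerField W p hp2 h7 hns P hP hh).fineMuZeroAt

/-! ## §2 Crux M AT THE PAIR from one class number, modulo the three printed binders of the lever ONLY -/

/-- **Crux M's body at the pair from `p ∤ h(ℚ(E[p]))`**, modulo the three PRINTED binders of the fine-pivot lever (Kurihara–Pollack
2007 §3 p. 328 and §1.2 p. 310, Matar 2020 Thm. 1.1) and NOTHING ELSE: no `CleanAtP`, no S1 stub, no Iwasawa-1956 fact.
[cite: CoatesSujatha2005, §3 Thm. 3.4, Lemma 3.8] [cite: KuriharaPollack2007, §1.2, §3 p. 328] [cite: Matar2020, Thm. 1.1] -/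
theorem oneSignMuZero_of_not_dvd_classNumber_divisionField [NeZero p]
    (hKP : kuriharaPollack2007_selmerDual_extension_of_fineDual) (hKo : signedSelmerInf_sub_fineSelmer_of_loc)
    (hMa : matar2020_thm11_selmerDualTorsion_pseudoIso_fineSelmerDual)
    (hp2 : p ≠ 2) (h7 : ClassX7 W p) (hap : W.frobeniusTrace p = 0) (hns : ¬ Surj W p)
    (hh : haveI : NumberField ↥(W.divisionField p) := NumberField.mk
      ¬ p ∣ NumberField.classNumber ↥(W.divisionField p)) :
    ∃ ε : ℤˣ, ∀ (κ : ZpExtension ℚ p) (γ : absoluteGaloisGroup ℚ), κ.IsCyclotomic → κ.IsTopGenerator γ →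
      IsCyclotomicVariable p γ → ∀ (D : SignedSelmerDualData W κ γ ε) (ξ : IwasawaAlgebra p),
        D.charIdeal = Ideal.span {ξ} → mu ξ = 0 :=
  SmallImageFinePivot.oneSignMuZero_of_conjAAt hKP hKo hMa W hp2 h7.1.1 hap
    (conjAAt_of_not_dvd_classNumber_divisionField W p hp2 h7 hns hh)

/-- **Crux M's body at the pair from `p ∤ h(ℚ(P))` for ONE non-zero `P ∈ E[p]`** — the shape a certificate row of the cell's kit
census ASK-1′ (`h(ℚ(P)) mod p`, degree `p² − 1`) instantiates — modulo the three PRINTED binders of the lever and NOTHING ELSE.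
[cite: DeoRaySujatha2023, §3 Thm. 3.9 (b)] [cite: CoatesSujatha2005, §3 Thm. 3.4, Lemma 3.8] [cite: KuriharaPollack2007, §3 p. 328]
[cite: Matar2020, Thm. 1.1] -/
theorem oneSignMuZero_of_not_dvd_classNumber_stabilizerField [NeZero p]
    (hKP : kuriharaPollack2007_selmerDual_extension_of_fineDual) (hKo : signedSelmerInf_sub_fineSelmer_of_loc)
    (hMa : matar2020_thm11_selmerDualTorsion_pseudoIso_fineSelmerDual)
    (hp2 : p ≠ 2) (h7 : ClassX7 W p) (hap : W.frobeniusTrace p = 0) (hns : ¬ Surj W p)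
    (P : geomTorsion W (p : ℤ)) (hP : P ≠ 0)
    (hh : haveI : NumberField ↥(W.divisionField p) := NumberField.mk
      ¬ p ∣ NumberField.classNumber ↥(fixedField
        ((MulAction.stabilizer (absoluteGaloisGroup ℚ) P).map (absRestrictNormalHom (W.divisionField p))))) :
    ∃ ε : ℤˣ, ∀ (κ : ZpExtension ℚ p) (γ : absoluteGaloisGroup ℚ), κ.IsCyclotomic → κ.IsTopGenerator γ →
      IsCyclotomicVariable p γ → ∀ (D : SignedSelmerDualData W κ γ ε) (ξ : IwasawaAlgebra p),
        D.charIdeal = Ideal.span {ξ} → mu ξ = 0 :=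
  SmallImageFinePivot.oneSignMuZero_of_conjAAt hKP hKo hMa W hp2 h7.1.1 hap
    (conjAAt_of_not_dvd_classNumber_stabilizerField W p hp2 h7 hns P hP hh)

/-! ## §3 The disprover's necessary condition (contrapositive) -/

/-- **NECESSARY CONDITION for a counterexample to crux M** (modulo the three prints): at a domain pair where M's body FAILS
(both `μ(X⁺) > 0` and `μ(X⁻) > 0`), `p` divides the class number of `ℚ(P)` for EVERY non-zero `P ∈ E[p]` — so every row of the
cell's ASK-1′ table with `p ∤ h(ℚ(P))` is a certified NON-witness; a candidate must also pass the eigen-test of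
`CoatesSujatha2005.conjA_of_eigenHom_subfield` on `Cl(ℚ(P)) ⊗ 𝔽_p`. [cite: DeoRaySujatha2023, §3 Thm. 3.9 (b)] [cite: CoatesSujatha2005, §3] -/
theorem dvd_classNumber_stabilizerField_of_not_oneSignMuZero [NeZero p]
    (hKP : kuriharaPollack2007_selmerDual_extension_of_fineDual) (hKo : signedSelmerInf_sub_fineSelmer_of_loc)
    (hMa : matar2020_thm11_selmerDualTorsion_pseudoIso_fineSelmerDual)
    (hp2 : p ≠ 2) (h7 : ClassX7 W p) (hap : W.frobeniusTrace p = 0) (hns : ¬ Surj W p)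
    (hM : ¬ ∃ ε : ℤˣ, ∀ (κ : ZpExtension ℚ p) (γ : absoluteGaloisGroup ℚ), κ.IsCyclotomic → κ.IsTopGenerator γ →
      IsCyclotomicVariable p γ → ∀ (D : SignedSelmerDualData W κ γ ε) (ξ : IwasawaAlgebra p),
        D.charIdeal = Ideal.span {ξ} → mu ξ = 0)
    (P : geomTorsion W (p : ℤ)) (hP : P ≠ 0) :
    haveI : NumberField ↥(W.divisionField p) := NumberField.mk
    p ∣ NumberField.classNumber ↥(fixedField
      ((MulAction.stabilizer (absoluteGaloisGroup ℚ) P).map (absRestrictNormalHom (W.divisionField p)))) := by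
  by_contra hh
  exact hM (oneSignMuZero_of_not_dvd_classNumber_stabilizerField W p hKP hKo hMa hp2 h7 hap hns P hP hh)

/-- The same necessary condition in the `ℚ(E[p])` currency: M fails at a domain pair ⟹ `p ∣ h(ℚ(E[p]))` (modulo the three prints).
[cite: CoatesSujatha2005, §3 Thm. 3.4] -/
theorem dvd_classNumber_divisionField_of_not_oneSignMuZero [NeZero p]
    (hKP : kuriharaPollack2007_selmerDual_extension_of_fineDual) (hKo : signedSelmerInf_sub_fineSelmer_of_loc)
    (hMa : matar2020_thm11_selmerDualTorsion_pseudoIso_fineSelmerDual)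
    (hp2 : p ≠ 2) (h7 : ClassX7 W p) (hap : W.frobeniusTrace p = 0) (hns : ¬ Surj W p)
    (hM : ¬ ∃ ε : ℤˣ, ∀ (κ : ZpExtension ℚ p) (γ : absoluteGaloisGroup ℚ), κ.IsCyclotomic → κ.IsTopGenerator γ →
      IsCyclotomicVariable p γ → ∀ (D : SignedSelmerDualData W κ γ ε) (ξ : IwasawaAlgebra p),
        D.charIdeal = Ideal.span {ξ} → mu ξ = 0) :
    haveI : NumberField ↥(W.divisionField p) := NumberField.mk
    p ∣ NumberField.classNumber ↥(W.divisionField p) := by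
  by_contra hh
  exact hM (oneSignMuZero_of_not_dvd_classNumber_divisionField W p hKP hKo hMa hp2 h7 hap hns hh)

end Summit.BirchSwinnertonDyer.BirchSwinnertonDyer.Theorems.SmallImageCleanAtP

end
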